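/-
Copyright: the b2b-balaban cell (near-miss cell 7), T⁴-continuum fan-out, round-2 swarm seat t4-ne7b-formalise-leaf-09
(row S3 of the lineage t4-ne7b-p1's claim table `t4/b2b-balaban-t4-ne7b-p1/LEAVES-NE7b.md`; node U5c COUNT member).
Released under the licence of the surrounding project.
-/
import Summits.QuantumFields.BalabanUV.T4Continuum.Support.HistoryGenBridge
import Summits.QuantumFields.BalabanUV.T4Continuum.Support.HistoryGenTimed
import Summits.QuantumFields.BalabanUV.T4Continuum.Support.HistorySlots

/-!
# History genealogies, part 6: the census predicates of row S7 on the pedigree's `PGen`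

Summits-side support leaf of the T⁴-continuum cell (rung (B)+1 on a FINITE torus only; NOT infinite volume, NOT the
mass gap, NOT the Clay statement; NOT a proof of the spine estimate NE7b).  Round-2 swarm `t4-ne7b-formalise-*`, row S3
(seat leaf-09).  [folklore] finite bookkeeping over the lineage's OWN carriers; nothing printed is asserted; no
`[cite:]` tag.

WHY.  Row S7 (`Support/HistorySlots`, leaf-10) states the socket's (H2e) side conditions — timing `PGen.Adm`, class cap
`ClassLT`, cells `CellsIn`, the fuel bound `fuel_toGen_le`, the root event `root_toGen` — on the owner's census carrier
`HistoryAdmissible.PGen`; the assembly instantiates the socket with the ADOPTED pedigree's tagged genealogy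
`Pedigree.genT` (R-OWNER-22-4).  This file reads S7's predicates on `Pedigree.toPGen cell c` (part 5) off PER-PART
facts of the pedigree, and transports the shape ∕ fuel ∕ events to `genT`, so that S7's lemmas apply to the members
`(z, genT c)` by name.

WHAT (for a pedigree whose renewed parts come from the previous step, `hS`).  `lastStep_chainJoin`,
`lastStep_toPGen_le`; **`adm_toPGen`** (`∀ c, step c ≤ K` ⇒ `(toPGen cell c).Adm K`); **`classLT_toPGen`** (every new
part of class `< D` ⇒ `ClassLT D`); **`cellsIn_toPGen`** (every new part's cell of the right age ⇒ `CellsIn`);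
**`shape_genT_eq_toGen`** (`relabel (shape ∘ Prod.fst) (genT c) = (toPGen cell c).toGen` — S7's «S3 exports …»);
`fuel_genT_eq`, **`fuel_genT_le`** (`fuel (genT c) ≤ card (toPGen cell c).evTypes`); `events_gen_eq_toGen`.

HONEST DEPENDENCY (cell): continuum YM on T⁴ ⇐ BetaPertH ∧ nine spine estimates (0/9 proved); BetaPertH ⇐ (D1) ∧ (D4)
∧ CAP+tail.  This file changes none of it.
-/

open Finset
open Literature.MathematicalPhysics.QuantumFieldTheory.Balaban1983to89
open T4PersistenceDictionary T4BranchingRecordsGas T4CanonicalMenus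
open Summit.QuantumFields.BalabanUV.T4Continuum.ZoneSkeleton
open Summit.QuantumFields.BalabanUV.T4Continuum.HistoryAdmissible
open Summit.QuantumFields.BalabanUV.T4Continuum.HistorySlots

namespace Summit.QuantumFields.BalabanUV.T4Continuum.HistoryGen

section Census

variable {α π γ : Type*}

/-! ## §1 Chains of joins: last step, timing, class cap, cells -/

/-- the last step of a real chain of joins is the join step [folklore] -/
theorem lastStep_chainJoin (s : ℕ) : ∀ (A : PGen γ) (Bs : List (PGen γ)), Bs ≠ [] → (chainJoin A Bs s).lastStep = s
  | _, [], h => absurd rfl h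
  | A, B :: Bs, _ => by
      rw [chainJoin]
      cases Bs with
      | nil => rfl
      | cons B' Bs' => exact lastStep_chainJoin s _ _ (List.cons_ne_nil _ _)

/-- a chain of joins at `s ≤ K` of members obeying the timing discipline with events `≤ s` obeys it [folklore] -/
theorem adm_chainJoin {K s : ℕ} (hs : s ≤ K) : ∀ (A : PGen γ) (Bs : List (PGen γ)),
    A.Adm K → A.lastStep ≤ s → (∀ B ∈ Bs, B.Adm K ∧ B.lastStep ≤ s) → (chainJoin A Bs s).Adm K
  | _, [], hA, _, _ => hA
  | A, B :: Bs, hA, hAl, hBs => by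
      rw [chainJoin]
      obtain ⟨hB, hBl⟩ := hBs B List.mem_cons_self
      exact adm_chainJoin hs _ Bs ⟨hA, hB, hAl, hBl, hs⟩ le_rfl fun B' hB' => hBs B' (List.mem_cons_of_mem _ hB')

/-- a chain of joins of members of classes `< D` has classes `< D` [folklore] -/
theorem classLT_chainJoin {D : ℕ} (s : ℕ) : ∀ (A : PGen γ) (Bs : List (PGen γ)),
    ClassLT D A → (∀ B ∈ Bs, ClassLT D B) → ClassLT D (chainJoin A Bs s)
  | _, [], hA, _ => hA
  | A, B :: Bs, hA, hBs => by
      rw [chainJoin]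
      exact classLT_chainJoin s _ Bs ⟨hA, hBs B List.mem_cons_self⟩ fun B' hB' => hBs B' (List.mem_cons_of_mem _ hB')

/-- a chain of joins of members with cells of the right age has cells of the right age [folklore] -/
theorem cellsIn_chainJoin {Cell : ℕ → ℕ → Finset γ} {K : ℕ} (s : ℕ) : ∀ (A : PGen γ) (Bs : List (PGen γ)),
    CellsIn Cell K A → (∀ B ∈ Bs, CellsIn Cell K B) → CellsIn Cell K (chainJoin A Bs s)
  | _, [], hA, _ => hA
  | A, B :: Bs, hA, hBs => by
      rw [chainJoin]
      exact cellsIn_chainJoin s _ Bs ⟨hA, hBs B List.mem_cons_self⟩ fun B' hB' => hBs B' (List.mem_cons_of_mem _ hB')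

namespace Pedigree

variable [Inhabited γ] (P : Pedigree α π) (cell : π → γ)

/-- a structural predicate holding for every part `PGen` holds for the join [folklore] -/
theorem joinP_induct {Q : PGen γ → Prop} (c : α)
    (hjoin : ∀ (A : PGen γ) (Bs : List (PGen γ)), Q A → (∀ B ∈ Bs, Q B) → Q (chainJoin A Bs (P.step c)))
    (hjunk : Q (PGen.birth (P.step c) 0 default)) {L : List (PGen γ)} (hL : ∀ M ∈ L, Q M) : Q (P.joinP c L) := by
  cases L with
  | nil => exact hjunk
  | cons A As => exact hjoin A As (hL A List.mem_cons_self) fun B hB => hL B (List.mem_cons_of_mem _ hB)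

/-! ## §2 The census predicates on `toPGen` -/

/-- the `PGen` of a component has its last event no later than the component's step [folklore] -/
theorem lastStep_toPGen_le (hS : ∀ c c', Part.old c' true ∈ P.parts c → P.step c' + 1 = P.step c) (c : α) :
    (P.toPGen cell c).lastStep ≤ P.step c := by
  rw [toPGen_eq]
  have hpart : ∀ q ∈ P.parts c, (P.partPGen cell c (P.toPGen cell) q).lastStep ≤ P.step c := by
    intro q hq
    rcases q with ⟨c', _ | _⟩ | ⟨d, x⟩
    · have hlt := P.step_lt c c' false hq
      exact (lastStep_toPGen_le hS c').trans hlt.le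
    · simp only [partPGen, PGen.lastStep]; exact (hS c c' hq).le
    · exact le_rfl
  cases hL : (P.parts c).map (P.partPGen cell c (P.toPGen cell)) with
  | nil => exact le_rfl
  | cons A As =>
      simp only [joinP]
      cases As with
      | nil =>
          have hA : A ∈ (P.parts c).map (P.partPGen cell c (P.toPGen cell)) := by rw [hL]; exact List.mem_cons_self
          obtain ⟨q, hq, rfl⟩ := List.mem_map.1 hA
          simpa [chainJoin] using hpart q hq
      | cons B Bs => exact (lastStep_chainJoin _ _ _ (List.cons_ne_nil _ _)).le
termination_by P.step c
decreasing_by exact hlt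

/-- **THE `PGen` OF A COMPONENT OBEYS THE TIMING DISCIPLINE `Adm K`** when every component is observed by the cutoff
(renewed parts from the previous step). [folklore] -/
theorem adm_toPGen {K : ℕ} (hK : ∀ c, P.step c ≤ K)
    (hS : ∀ c c', Part.old c' true ∈ P.parts c → P.step c' + 1 = P.step c) (c : α) : (P.toPGen cell c).Adm K := by
  rw [toPGen_eq]
  have hpart : ∀ q ∈ P.parts c, (P.partPGen cell c (P.toPGen cell) q).Adm K ∧
      (P.partPGen cell c (P.toPGen cell) q).lastStep ≤ P.step c := by
    intro q hq
    rcases q with ⟨c', _ | _⟩ | ⟨d, x⟩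
    · have hlt := P.step_lt c c' false hq
      exact ⟨adm_toPGen hK hS c', (P.lastStep_toPGen_le cell hS c').trans hlt.le⟩
    · have hlt := P.step_lt c c' true hq
      have hs := hS c c' hq
      refine ⟨⟨adm_toPGen hK hS c', P.lastStep_toPGen_le cell hS c', ?_⟩, ?_⟩
      · rw [hs]; exact hK c
      · simp only [partPGen, PGen.lastStep]; exact hs.le
    · exact ⟨hK c, le_rfl⟩
  have key : (P.joinP c ((P.parts c).map (P.partPGen cell c (P.toPGen cell)))).Adm K ∧
      (P.joinP c ((P.parts c).map (P.partPGen cell c (P.toPGen cell)))).lastStep ≤ P.step c :=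
    P.joinP_induct (Q := fun M => M.Adm K ∧ M.lastStep ≤ P.step c) c
      (fun A Bs hA hBs => ⟨adm_chainJoin (hK c) A Bs hA.1 hA.2 hBs, by
        cases Bs with
        | nil => exact hA.2
        | cons B Bs' => exact (lastStep_chainJoin _ _ _ (List.cons_ne_nil _ _)).le⟩)
      ⟨hK c, le_rfl⟩ fun M hM => by
        obtain ⟨q, hq, rfl⟩ := List.mem_map.1 hM
        exact hpart q hq
  exact key.1
termination_by P.step c
decreasing_by all_goals exact hlt

/-- **CLASS CAP**: if every new part of every component has class `< D`, the `PGen` of every component has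
`ClassLT D` (row S7's hypothesis of `fat_lt_of_classLT`). [folklore] -/
theorem classLT_toPGen {D : ℕ} (hD0 : 0 < D) (hD : ∀ c d x, Part.new d x ∈ P.parts c → d < D) (c : α) :
    ClassLT D (P.toPGen cell c) := by
  rw [toPGen_eq]
  have hpart : ∀ q ∈ P.parts c, ClassLT D (P.partPGen cell c (P.toPGen cell) q) := by
    intro q hq
    rcases q with ⟨c', _ | _⟩ | ⟨d, x⟩
    · have hlt := P.step_lt c c' false hq
      exact classLT_toPGen hD0 hD c'
    · have hlt := P.step_lt c c' true hq
      exact classLT_toPGen hD0 hD c'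
    · exact hD c d x hq
  refine P.joinP_induct c (fun A Bs hA hBs => classLT_chainJoin _ A Bs hA hBs) hD0 ?_
  intro M hM
  obtain ⟨q, hq, rfl⟩ := List.mem_map.1 hM
  exact hpart q hq
termination_by P.step c
decreasing_by all_goals exact hlt

/-- **CELLS**: if every new part of a component of step `j` is rooted (by `cell`) at a cell of age `K − j`, the `PGen` of
every component has `CellsIn Cell K` (row S7's hypothesis of `rootCell_mem`). [folklore] -/
theorem cellsIn_toPGen {Cell : ℕ → ℕ → Finset γ} {K : ℕ} (hjunk : ∀ c, (default : γ) ∈ Cell K (K - P.step c))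
    (hC : ∀ c d x, Part.new d x ∈ P.parts c → cell x ∈ Cell K (K - P.step c)) (c : α) :
    CellsIn Cell K (P.toPGen cell c) := by
  rw [toPGen_eq]
  have hpart : ∀ q ∈ P.parts c, CellsIn Cell K (P.partPGen cell c (P.toPGen cell) q) := by
    intro q hq
    rcases q with ⟨c', _ | _⟩ | ⟨d, x⟩
    · have hlt := P.step_lt c c' false hq
      exact cellsIn_toPGen hjunk hC c'
    · have hlt := P.step_lt c c' true hq
      exact cellsIn_toPGen hjunk hC c'
    · exact hC c d x hq
  refine P.joinP_induct c (fun A Bs hA hBs => cellsIn_chainJoin _ A Bs hA hBs) (hjunk c) ?_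
  intro M hM
  obtain ⟨q, hq, rfl⟩ := List.mem_map.1 hM
  exact hpart q hq
termination_by P.step c
decreasing_by all_goals exact hlt

/-! ## §3 Shape, events and fuel of the tagged genealogy through the census carrier -/

/-- the flat events are the canonical label's [folklore] -/
theorem events_gen_eq_toGen (hS : ∀ c c', Part.old c' true ∈ P.parts c → P.step c' + 1 = P.step c) (c : α) :
    (P.gen c).events = (P.toPGen cell c).toGen.events := by
  rw [P.toGen_toPGen cell hS c]

variable [DecidableEq α] [DecidableEq π]

/-- **S7's «S3 exports»**: the shape tree of the tagged genealogy IS the canonical label of the component's `PGen`.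
[folklore] -/
theorem shape_genT_eq_toGen (hS : ∀ c c', Part.old c' true ∈ P.parts c → P.step c' + 1 = P.step c) (c : α) :
    relabel (shape ∘ Prod.fst) (P.genT c) = (P.toPGen cell c).toGen := by
  rw [P.relabel_shape_genT c, P.toGen_toPGen cell hS c]

/-- the fuel of the tagged genealogy is the canonical label's [folklore] -/
theorem fuel_genT_eq (hS : ∀ c c', Part.old c' true ∈ P.parts c → P.step c' + 1 = P.step c) (c : α) :
    fuel (P.genT c) = fuel (P.toPGen cell c).toGen := by
  rw [← P.shape_genT_eq_toGen cell hS c, fuel_relabel]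

/-- **FUEL CAP**: the fuel of the tagged genealogy is at most the number of events of the component's physical
genealogy (row S7's `fuel_toGen_le`). [folklore] -/
theorem fuel_genT_le (hS : ∀ c c', Part.old c' true ∈ P.parts c → P.step c' + 1 = P.step c) (c : α) :
    fuel (P.genT c) ≤ Multiset.card (P.toPGen cell c).evTypes := by
  rw [P.fuel_genT_eq cell hS c]; exact fuel_toGen_le _

end Pedigree

end Census

end Summit.QuantumFields.BalabanUV.T4Continuum.HistoryGen
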